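import Summits.ResolutionOfSingularities.ResolutionOfSingularities.Theorems.AQSHeightTwoPlusStalkAffine
import Literature.AlgebraicGeometry.Resolution.AdicOrderBasics
import HarnessLib

/-!
# (o25) «F-AQS-T in the kernel», piece (γ2) — PLUS-STALK: the local rings of the datum-style cobordant blow-up `B₊(U)` are
# local rings of the GAME ring over `𝒪_{Y,y}`, and the ORDER READ-OFF of the strict transform

Route `ResolutionOfSingularities/WeightedInvariant`, crux `Theses.WeightedInvariant.HypersurfaceCentreConstruction`
(stmt-ResolutionOfSingularities-19897), door line `local-engine`, rung `e = 1`: ORDER (o25) of res-L1-w43-plan-1 (make the named fact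
`AbramovichQuekSchober2025_heightTwoCentre` a kernel theorem), design of record res-type-092's `O25-DESIGN.md` §2, piece **(γ2)
PLUS-STALK** (holder res-type-089, second hand res-type-057; RULING gen 9 #6 and its AMENDMENT 2026-08-27T09:50Z).  Sequel of BRICK A
(`AQSHeightTwoPlusStalkAffine.lean`, res-type-057: the affine stalk model `Ψ₀ : 𝒪_{B₊(U), b} ≃+* (Γ(U)[t⁻¹, Rₙ(U) tⁿ])_q`).

For a Rees algebra `R` on a scheme `Y`, an affine open `U = Spec A` whose chart ideals `Rₙ(U)` decrease (automatic on a weighted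
chart), a point `b` of `B₊(U) = R.cobordantPlus U` with base point `y ∈ U`, ANY local model `A'` of `𝒪_{Y,y}` (a localisation of
`A` at the prime `𝔭_y` of `y`: the stalk itself, or `Localization.AtPrime 𝔭_y`) and the GAME ring `A'[t⁻¹, I'ₙ tⁿ] = extReesAlgebra I'`
of the localised pieces `I'ₙ = Rₙ(U) A'`:

* `extReesAlgebra.exists_prime_ringEquiv_localization_T` — **the game ring localises at a prime**: for a prime `q` of `A[t⁻¹, Iₙ tⁿ]`
  missing a submonoid `M ≤ A` and `A' = M⁻¹A`, a prime `𝔫'` of `A'[t⁻¹, I'ₙ tⁿ]` and `g : (A[t⁻¹, Iₙ tⁿ])_q ≃+* (A'[t⁻¹, I'ₙ tⁿ])_{𝔫'}`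
  with the dictionary (i) structure maps from `A`, (ii) `t⁻¹ ∈ 𝔫' ↔ t⁻¹ ∈ q`, (iii) vertex ideals, (iv) base primes, (v) `g (t⁻¹/1) =
  t⁻¹/1` (the three-algebra bridge `IdealFiltration.exists_ringEquiv_extReesAlgebra` + res-type-048's package
  `exists_prime_extReesAlgebra_ringEquiv_localization_T`);
* `extReesAlgebra.tInv_mem_of_forall_le_comap` — a prime off the vertex and over a point of `V(Iₙ : n ≥ 1)` contains `t⁻¹`;
* `idealOrder_le_adicOrder_of_mem` — `ord_x(I) ≤ ord(z)` for every `z ∈ I_x` (the equality for a principal stalk is res-type-057's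
  `idealOrder_eq_adicOrder_of_stalkIdeal_eq_span`, `AQSHeightTwoOrderReadOff.lean`);
* **`ReesAlgebraData.exists_gameSide_stalk_model_cobordantPlus`** — a prime `𝔫'` of the game ring, off the vertex, over `𝔪_{A'}`,
  containing `t⁻¹` when `y ∈ supp R`, and `Ψ : 𝒪_{B₊(U), b} ≃+* (A'[t⁻¹, I'ₙ tⁿ])_{𝔫'}` carrying the stalk of the strict transform
  `R.cobordantStrictTransform U X` of EVERY ideal sheaf `X` onto the `t⁻¹`-saturation `⋃ₙ (X(U) · (A'[t⁻¹, I'ₙ tⁿ])_{𝔫'} : (t⁻¹/1)ⁿ)`;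
* **`ReesAlgebraData.idealOrder_cobordantStrictTransform_le_adicOrder`** — the ORDER READ-OFF: for `f ∈ X(U) A'` and ANY factorisation
  `f = (t⁻¹)ᵃ g` in the game ring, `idealOrder (R.cobordantStrictTransform U X) b ≤ adicOrder (g/1 ∈ (A'[t⁻¹, I'ₙ tⁿ])_{𝔫'})` — exactly
  the premise set of (β2) `adicOrder_transform_lt`; and its weighted-chart spelling
  `ReesAlgebraData.IsWeightedChart.idealOrder_cobordantStrictTransform_le_adicOrder` (`I'ₙ = (u^α : w·α ≥ n)` on the images of the
  chart parameters).
The base point is a free variable `y` (`R.cobordantPlusι U b = y`): a consumer holding `η` and `b` over it instantiates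
without transport.  Def-free helper (`--supports stmt-ResolutionOfSingularities-19897`); OURS bookkeeping — nothing here is a claim about resolution of
singularities in positive characteristic or about the cited paper beyond its typed statement.  AI-written; weaker than expert review.
[cite: Wlodarczyk2022, Def. 2.3.5; 3.3.12; Def. 5.1.1]
-/

noncomputable section

set_option linter.dupNamespace false -- mandated namespace of this single-conjunct summit

open CategoryTheory AlgebraicGeometry TopologicalSpace IsLocalRing
open scoped LaurentPolynomial
open LaurentPolynomial
open Literature.AlgebraicGeometry.Resolution
open Summit.ResolutionOfSingularities.ResolutionOfSingularities.Theorems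
open Summit.ResolutionOfSingularities.ResolutionOfSingularities.Cruxes.HypersurfaceCentreConstruction.LocalEngine

namespace Summit.ResolutionOfSingularities.ResolutionOfSingularities.Theorems.AQSHeightTwo

/-! ## Generic bricks -/

section Generic

universe u

/-- **`ord_x(I) ≤ ord(z)` for every `z ∈ I_x`**: the order of an ideal sheaf at a point is at most the `𝔪`-adic order of any
element of its stalk (`I_x ⊆ 𝔪ⁿ ⇒ z ∈ 𝔪ⁿ`). [cite: BierstoneGrigorievMilmanWlodarczyk2011, §3.1 p. 6] -/
theorem idealOrder_le_adicOrder_of_mem {X : Scheme.{u}} (I : X.IdealSheafData) (x : X) {z : X.presheaf.stalk x}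
    (hz : z ∈ stalkIdeal I x) : idealOrder I x ≤ adicOrder z := by
  refine ENat.forall_natCast_le_iff_le.mp fun n hn => ?_
  rw [le_adicOrder_iff]
  exact (le_idealOrder_iff I x n).mp hn hz

/-- `ord_x(I) ≤ ord(z)` for every `z` in the image of `I_x` under a ring isomorphism `Ψ : 𝒪_{X,x} ≃+* S` onto a local ring
(`idealOrder_le_adicOrder_of_mem` + `adicOrder_map_ringEquiv`; `S` generic so that all its instances derive from the binder). [folklore] -/
theorem idealOrder_le_adicOrder_of_mem_map {X : Scheme.{u}} (I : X.IdealSheafData) (x : X) {S : Type*} [CommRing S]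
    [IsLocalRing S] (Ψ : X.presheaf.stalk x ≃+* S) {z : S}
    (hz : z ∈ (stalkIdeal I x).map (Ψ : X.presheaf.stalk x →+* S)) : idealOrder I x ≤ adicOrder z := by
  rw [Ideal.map_comap_of_equiv, Ideal.mem_comap] at hz
  calc idealOrder I x ≤ adicOrder (Ψ.symm z) := idealOrder_le_adicOrder_of_mem I x hz
    _ = adicOrder (Ψ (Ψ.symm z)) := (adicOrder_map_ringEquiv Ψ _).symm
    _ = adicOrder z := by rw [Ψ.apply_symm_apply]

/-- `z tᵃ ∈ J ⇒ z ∈ ⋃ₙ (J : tⁿ)`. [folklore] -/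
theorem mem_iSup_colon_of_mul_pow_mem {S : Type*} [CommRing S] (J : Ideal S) (t z : S) (a : ℕ) (h : z * t ^ a ∈ J) :
    z ∈ ⨆ n : ℕ, J.colon {t ^ n} :=
  (le_iSup (fun n : ℕ => J.colon {t ^ n}) a) (by rw [Submodule.mem_colon_singleton, smul_eq_mul]; exact h)

/-- A factorisation `x = tᵃ g` read through a ring map: `φ g · (φ t)ᵃ ∈ J` whenever `φ x ∈ J` (binders generic, so that the
carriers are assigned by unification from `φ`). [folklore] -/
theorem map_mul_map_pow_mem_of_eq {B C : Type*} [CommRing B] [CommRing C] (φ : B →+* C) {x t g : B} {a : ℕ}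
    (h : x = t ^ a * g) {J : Ideal C} (hx : φ x ∈ J) : φ g * φ t ^ a ∈ J := by
  rw [h, map_mul, map_pow, mul_comm] at hx
  exact hx

/-- Membership in a basic open in terms of the prime of the point (as in `Resolution/BlowupSNC`). [folklore] -/
private theorem mem_basicOpen_iff_not_mem_primeIdealOf' {X : Scheme.{u}} {x : X} (U : X.affineOpens)
    (hxU : x ∈ (U : X.Opens)) (g : Γ(X, U)) : x ∈ X.basicOpen g ↔ g ∉ (U.2.primeIdealOf ⟨x, hxU⟩).asIdeal := by
  rw [← PrimeSpectrum.mem_basicOpen, ← U.2.fromSpec_preimage_basicOpen g]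
  change _ ↔ U.2.fromSpec (U.2.primeIdealOf ⟨x, hxU⟩) ∈ X.basicOpen g
  rw [U.2.fromSpec_primeIdealOf ⟨x, hxU⟩]

/-- The ideal of an ideal sheaf on an affine chart lies in the prime of every point of its support there. [folklore] -/
theorem ideal_le_primeIdealOf_of_mem_support' {X : Scheme.{u}} (I : X.IdealSheafData) (U : X.affineOpens) {x : X}
    (hxU : x ∈ (U : X.Opens)) (hx : x ∈ I.support) : I.ideal U ≤ (U.2.primeIdealOf ⟨x, hxU⟩).asIdeal := by
  intro g hg
  rw [Scheme.IdealSheafData.mem_support_iff_of_mem (U := U) hxU, Scheme.mem_zeroLocus_iff] at hx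
  have h := hx g hg
  rw [mem_basicOpen_iff_not_mem_primeIdealOf' U hxU g, not_not] at h
  exact h

variable {A : Type u} [CommRing A]

/-- **A prime of `A[t⁻¹, Iₙ tⁿ]` off the vertex and over a point of `V(Iₙ : n ≥ 1)` contains `t⁻¹`**: if `Iₙ ⊆ q ∩ A` for all
`n ≥ 1` but the vertex ideal `(a tⁿ : n ≥ 1, a ∈ Iₙ)` is not contained in `q`, then `t⁻¹ ∈ q` — for `a tⁿ · (t⁻¹)ⁿ = a ∈ q`.
(The points of `B₊` over the support of the centre lie on the exceptional divisor `V(t⁻¹)`.) [cite: Wlodarczyk2022, Lemma 2.3.8] -/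
theorem _root_.Literature.AlgebraicGeometry.Resolution.extReesAlgebra.tInv_mem_of_forall_le_comap (I : ℕ → Ideal A)
    (q : Ideal (extReesAlgebra I)) [q.IsPrime]
    (hI : ∀ n, 0 < n → I n ≤ q.comap (algebraMap A (extReesAlgebra I)))
    (hv : ¬ extReesAlgebra.vertexIdeal I ≤ q) : extReesAlgebra.tInv I ∈ q := by
  by_contra ht
  apply hv
  rw [extReesAlgebra.vertexIdeal, Ideal.span_le]
  rintro x ⟨n, hn, a, ha, hx⟩
  -- `x · (t⁻¹)ⁿ = a`
  have hxa : x * extReesAlgebra.tInv I ^ n = algebraMap A (extReesAlgebra I) a := by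
    apply Subtype.ext
    rw [Subalgebra.coe_mul, Subalgebra.coe_pow, extReesAlgebra.coe_tInv, Subalgebra.coe_algebraMap, hx,
      ← C_eq_algebraMap, T_pow, mul_T_assoc]
    have h0 : (n : ℤ) + (n : ℤ) * (-1) = 0 := by ring
    rw [h0, T_zero, mul_one]
  have hmem : x * extReesAlgebra.tInv I ^ n ∈ q := by
    rw [hxa]
    exact Ideal.mem_comap.mp (hI n hn ha)
  exact (‹q.IsPrime›.mem_or_mem hmem).resolve_right fun h => ht (‹q.IsPrime›.mem_of_pow_mem n h)

end Generic

/-! ## The game ring localises at a prime (`extReesAlgebra I` → `extReesAlgebra I'`, any submonoid) -/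

section GameRingLocalises

variable {A : Type} [CommRing A] {A' : Type} [CommRing A'] [Algebra A A']

/-- **The game ring localises at a prime.**  For a descending multiplicative sequence of ideals `I` of `A` (`I₀ = A`), a
localisation `A' = M⁻¹A`, the localised pieces `I'ₙ = Iₙ A'` and a prime `q` of `A[t⁻¹, Iₙ tⁿ] = extReesAlgebra I` missing `M`: there
are a prime `𝔫'` of `A'[t⁻¹, I'ₙ tⁿ] = extReesAlgebra I'` and a ring isomorphism `g : (A[t⁻¹, Iₙ tⁿ])_q ≃+* (A'[t⁻¹, I'ₙ tⁿ])_{𝔫'}` with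
(i) matching structure maps from `A`, (ii) `t⁻¹ ∈ 𝔫' ↔ t⁻¹ ∈ q`, (iii) `vertexIdeal I' ≤ 𝔫' ↔ vertexIdeal I ≤ q`, (iv) for every
`𝔭 ≤ A`: `(𝔭A') · A'[t⁻¹, I'ₙ tⁿ] ≤ 𝔫' ↔ 𝔭 · A[t⁻¹, Iₙ tⁿ] ≤ q`, (v) `g (t⁻¹/1) = t⁻¹/1` (through the coefficientwise model
`⊕ Iₙ tⁿ`, `IdealFiltration.exists_ringEquiv_extReesAlgebra`, and res-type-048's package on it).  Włodarczyk, App. Def. 5.1.1: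
`B = Spec_X(R[t⁻¹])` is a relative spectrum, so its local rings over `y` only see the stalk filtration. [cite: Wlodarczyk2022, Def. 5.1.1] -/
theorem _root_.Literature.AlgebraicGeometry.Resolution.extReesAlgebra.exists_prime_ringEquiv_localization_T
    (I : ℕ → Ideal A) (hI0 : I 0 = ⊤) (hanti : Antitone I) (hmul : ∀ m n, I m * I n ≤ I (m + n))
    (M : Submonoid A) [IsLocalization M A']
    {I' : ℕ → Ideal A'} (hI' : ∀ n, I' n = (I n).map (algebraMap A A'))
    (q : Ideal (extReesAlgebra I)) [q.IsPrime]
    (hd : Disjoint ((M.map (algebraMap A (extReesAlgebra I)) : Submonoid (extReesAlgebra I)) : Set (extReesAlgebra I)) q) :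
    ∃ (𝔫' : Ideal (extReesAlgebra I')) (_ : 𝔫'.IsPrime)
      (g : Localization.AtPrime q ≃+* Localization.AtPrime 𝔫'),
      (∀ a : A, g (algebraMap (extReesAlgebra I) (Localization.AtPrime q) (algebraMap A (extReesAlgebra I) a)) =
          algebraMap (extReesAlgebra I') _ (algebraMap A' (extReesAlgebra I') (algebraMap A A' a))) ∧
      (extReesAlgebra.tInv I' ∈ 𝔫' ↔ extReesAlgebra.tInv I ∈ q) ∧
      (extReesAlgebra.vertexIdeal I' ≤ 𝔫' ↔ extReesAlgebra.vertexIdeal I ≤ q) ∧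
      (∀ 𝔭 : Ideal A, (𝔭.map (algebraMap A A')).map (algebraMap A' (extReesAlgebra I')) ≤ 𝔫' ↔
          𝔭.map (algebraMap A (extReesAlgebra I)) ≤ q) ∧
      g (algebraMap (extReesAlgebra I) (Localization.AtPrime q) (extReesAlgebra.tInv I)) =
        algebraMap (extReesAlgebra I') _ (extReesAlgebra.tInv I') := by
  -- the coefficientwise model `⊕ Iₙ tⁿ` of `A[t⁻¹, Iₙ tⁿ]`
  let F : IdealFiltration A := { ideal := I, ideal_zero := hI0, antitone := hanti, mul_le := hmul }
  have hFI : F.ideal = I := rfl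
  have he0 := F.exists_ringEquiv_extReesAlgebra hFI
  obtain ⟨e, he⟩ := he0
  -- `(A[t⁻¹, Iₙ tⁿ])_q ≃ (⊕ Iₙ tⁿ)_{e q}`
  have hf0 := IdealFiltration.exists_ringEquiv_localization F e q
  obtain ⟨f₁, hf₁⟩ := hf0
  -- `e q` misses `M`
  have hd' : Disjoint ((M.map (algebraMap A F.extendedRees) : Submonoid F.extendedRees) : Set F.extendedRees)
      (q.map e) := by
    rw [Set.disjoint_left]
    rintro _ ⟨a, ha, rfl⟩ hmem
    have h1 : algebraMap A F.extendedRees a = e (algebraMap A (extReesAlgebra I) a) := (apply_algebraMap_eq e he a).symm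
    rw [SetLike.mem_coe, h1, Ideal.apply_mem_of_equiv_iff] at hmem
    exact Set.disjoint_left.mp hd ⟨a, ha, rfl⟩ hmem
  -- res-type-048's package on the coefficientwise model
  have hpk := exists_prime_extReesAlgebra_ringEquiv_localization_T F M hI' (q.map e) hd'
  obtain ⟨𝔫', h𝔫', g, hgbase, hgT, hgvert, hgprime, hgtInv⟩ := hpk
  have hqe : (q.map e).comap e = q := Ideal.comap_map_of_bijective e e.bijective
  refine ⟨𝔫', h𝔫', f₁.trans g, fun a => ?_, ?_, ?_, fun 𝔭 => ?_, ?_⟩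
  · rw [RingEquiv.trans_apply, hf₁, apply_algebraMap_eq e he a]
    exact hgbase a
  · rw [hgT, ← F.ringEquiv_tInv e he, Ideal.apply_mem_of_equiv_iff]
  · rw [hgvert, F.irrelevant_le_iff_vertexIdeal_le_comap e he hFI, hqe]
  · rw [hgprime 𝔭, ← map_map_algebraMap_eq e he 𝔭, Ideal.map_le_iff_le_comap, hqe]
  · rw [RingEquiv.trans_apply, hf₁, F.ringEquiv_tInv e he]
    exact hgtInv

end GameRingLocalises

/-! ## The game-side model of the local rings of `B₊(U)` -/

section Rees

variable {Y : Scheme.{0}} (R : ReesAlgebraData Y) (U : Y.affineOpens)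

/-- The chart ideals start with the unit ideal: `R₀(U) = Γ(U)`. [folklore] -/
theorem _root_.Literature.AlgebraicGeometry.Resolution.ReesAlgebraData.chartIdeals_zero : R.chartIdeals U 0 = ⊤ := by
  rw [ReesAlgebraData.chartIdeals_apply, R.piece_zero]
  rfl

/-- The chart ideals are multiplicative: `Rₘ(U) Rₙ(U) ⊆ Rₘ₊ₙ(U)`. [folklore] -/
theorem _root_.Literature.AlgebraicGeometry.Resolution.ReesAlgebraData.chartIdeals_mul_le (m n : ℕ) :
    R.chartIdeals U m * R.chartIdeals U n ≤ R.chartIdeals U (m + n) := by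
  have h := (Scheme.IdealSheafData.le_def.mp (R.piece_mul_le m n)) U
  rw [Scheme.IdealSheafData.ideal_mul, Pi.mul_apply] at h
  exact h

/-- On a weighted chart the chart ideals decrease. [cite: Wlodarczyk2022, Lemma 2.1.12] -/
theorem _root_.Literature.AlgebraicGeometry.Resolution.ReesAlgebraData.IsWeightedChart.chartIdeals_antitone {m : ℕ}
    {u : Fin m → Γ(Y, U)} {w : Fin m → ℕ} (h : R.IsWeightedChart U u w) : Antitone (R.chartIdeals U) := by
  intro a c hac
  rw [ReesAlgebraData.chartIdeals_apply, ReesAlgebraData.chartIdeals_apply, h.ideal_eq, h.ideal_eq]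
  exact weightedMonomialIdeal_antitone u w hac

/-- On a weighted chart the localised pieces are the weighted monomial ideals of the images of the parameters.
[cite: Wlodarczyk2022, Lemma 2.1.12] -/
theorem _root_.Literature.AlgebraicGeometry.Resolution.ReesAlgebraData.IsWeightedChart.weightedMonomialIdeal_map_eq {m : ℕ}
    {u : Fin m → Γ(Y, U)} {w : Fin m → ℕ} (h : R.IsWeightedChart U u w) {A' : Type} [CommRing A'] [Algebra Γ(Y, U) A']
    (n : ℕ) : weightedMonomialIdeal (fun i => algebraMap Γ(Y, U) A' (u i)) w n =
      (R.chartIdeals U n).map (algebraMap Γ(Y, U) A') := by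
  rw [ReesAlgebraData.chartIdeals_apply, h.ideal_eq, weightedMonomialIdeal_map]

/-- **(γ2) THE GAME-SIDE MODEL of the local rings of `B₊(U)`.**  Let `R` be a Rees algebra on `Y`, `U = Spec A` an affine open
with decreasing chart ideals, `b` a point of `B₊(U) = R.cobordantPlus U` with base point `y ∈ U`, `A'` a local model of `𝒪_{Y,y}`
(a localisation of `A` at the prime of `y`) and `I'ₙ = Rₙ(U) A'`.  Then there are a prime `𝔫'` of the game ring
`A'[t⁻¹, I'ₙ tⁿ] = extReesAlgebra I'` and a ring isomorphism `Ψ : 𝒪_{B₊(U), b} ≃+* (A'[t⁻¹, I'ₙ tⁿ])_{𝔫'}` carrying, for EVERY ideal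
sheaf `X` on `Y`, the stalk of the strict transform `R.cobordantStrictTransform U X` onto the `t⁻¹`-saturation
`⋃ₙ (X(U) · (A'[t⁻¹, I'ₙ tⁿ])_{𝔫'} : (t⁻¹/1)ⁿ)`; `𝔫'` is off the vertex, lies over `𝔪_{A'}`, and contains `t⁻¹` when `y ∈ supp R`
(BRICK A `exists_stalk_ringEquiv_cobordantPlus` + `extReesAlgebra.exists_prime_ringEquiv_localization_T` at `M = A ∖ 𝔭_y` +
`map_iSup_colon_singleton_pow_of_ringEquiv` + `extReesAlgebra.tInv_mem_of_forall_le_comap`).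
[cite: Wlodarczyk2022, Def. 5.1.1; 3.3.12] -/
theorem _root_.Literature.AlgebraicGeometry.Resolution.ReesAlgebraData.exists_gameSide_stalk_model_cobordantPlus
    (hanti : Antitone (R.chartIdeals U)) (b : R.cobordantPlus U) (y : Y) (hy : y ∈ (U : Y.Opens))
    (hb : R.cobordantPlusι U b = y)
    {A' : Type} [CommRing A'] [IsLocalRing A'] [Algebra Γ(Y, U) A']
    [IsLocalization.AtPrime A' (U.2.primeIdealOf ⟨y, hy⟩).asIdeal]
    {I' : ℕ → Ideal A'} (hI' : ∀ n, I' n = (R.chartIdeals U n).map (algebraMap Γ(Y, U) A')) :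
    ∃ (𝔫' : Ideal (extReesAlgebra I')) (_ : 𝔫'.IsPrime)
      (Ψ : (R.cobordantPlus U).presheaf.stalk b ≃+* Localization.AtPrime 𝔫'),
      (∀ X : Y.IdealSheafData,
        (stalkIdeal (R.cobordantStrictTransform U X) b).map
            (Ψ : (R.cobordantPlus U).presheaf.stalk b →+* Localization.AtPrime 𝔫') =
          ⨆ n : ℕ, ((((X.ideal U).map (algebraMap Γ(Y, U) A')).map (algebraMap A' (extReesAlgebra I'))).map
            (algebraMap (extReesAlgebra I') (Localization.AtPrime 𝔫'))).colon
            {algebraMap (extReesAlgebra I') (Localization.AtPrime 𝔫') (extReesAlgebra.tInv I') ^ n}) ∧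
      ¬ extReesAlgebra.vertexIdeal I' ≤ 𝔫' ∧
      (maximalIdeal A').map (algebraMap A' (extReesAlgebra I')) ≤ 𝔫' ∧
      (y ∈ R.support → extReesAlgebra.tInv I' ∈ 𝔫') := by
  subst hb
  -- the prime `q` of `A[t⁻¹, Rₙ(U) tⁿ]` under `b`
  have hq0 : ∃ q : PrimeSpectrum (extReesAlgebra (R.chartIdeals U)),
      (affineCobordantBlowup.plusOpens (R.chartIdeals U)).ι b = q := ⟨_, rfl⟩
  obtain ⟨q, hq⟩ := hq0
  haveI : q.asIdeal.IsPrime := q.isPrime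
  -- BRICK A: the affine stalk model
  have hA := R.exists_stalk_ringEquiv_cobordantPlus U b q hq
  obtain ⟨Ψ₀, hΨ₀⟩ := hA
  -- the base prime `𝔭_y = q ∩ A`
  have h𝔭 : (U.2.primeIdealOf ⟨R.cobordantPlusι U b, hy⟩).asIdeal =
      q.asIdeal.comap (algebraMap Γ(Y, U) (extReesAlgebra (R.chartIdeals U))) :=
    R.primeIdealOf_cobordantPlusι_asIdeal U b q hq
  -- `q` misses `A ∖ 𝔭_y`
  have hd : Disjoint (((U.2.primeIdealOf ⟨R.cobordantPlusι U b, hy⟩).asIdeal.primeCompl.map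
      (algebraMap Γ(Y, U) (extReesAlgebra (R.chartIdeals U))) : Submonoid (extReesAlgebra (R.chartIdeals U))) :
        Set (extReesAlgebra (R.chartIdeals U))) (q.asIdeal : Set (extReesAlgebra (R.chartIdeals U))) := by
    rw [Set.disjoint_left]
    rintro s ⟨a, ha, rfl⟩ hs
    exact ha (show a ∈ (U.2.primeIdealOf ⟨R.cobordantPlusι U b, hy⟩).asIdeal by rw [h𝔭]; exact hs)
  -- the game ring localises at `q`
  have hpk := extReesAlgebra.exists_prime_ringEquiv_localization_T (R.chartIdeals U) (R.chartIdeals_zero U) hanti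
    (R.chartIdeals_mul_le U) (U.2.primeIdealOf ⟨R.cobordantPlusι U b, hy⟩).asIdeal.primeCompl hI' q.asIdeal hd
  obtain ⟨𝔫', h𝔫', g, hgbase, hgT, hgvert, hgprime, hgtInv⟩ := hpk
  -- the structure maps `A → (A'[t⁻¹, I'ₙ tⁿ])_{𝔫'}` through `(A[t⁻¹, Rₙ(U) tⁿ])_q` and through `A'` agree
  have hcomp : ((g : Localization.AtPrime q.asIdeal →+* Localization.AtPrime 𝔫').comp
      (algebraMap (extReesAlgebra (R.chartIdeals U)) (Localization.AtPrime q.asIdeal))).comp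
        (algebraMap Γ(Y, U) (extReesAlgebra (R.chartIdeals U))) =
      ((algebraMap (extReesAlgebra I') (Localization.AtPrime 𝔫')).comp
        (algebraMap A' (extReesAlgebra I'))).comp (algebraMap Γ(Y, U) A') :=
    RingHom.ext fun a => hgbase a
  have hJ : ∀ X : Y.IdealSheafData, (((X.ideal U).map (algebraMap Γ(Y, U) (extReesAlgebra (R.chartIdeals U)))).map
      (algebraMap (extReesAlgebra (R.chartIdeals U)) (Localization.AtPrime q.asIdeal))).map
      (g : Localization.AtPrime q.asIdeal →+* Localization.AtPrime 𝔫') =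
      (((X.ideal U).map (algebraMap Γ(Y, U) A')).map (algebraMap A' (extReesAlgebra I'))).map
        (algebraMap (extReesAlgebra I') (Localization.AtPrime 𝔫')) := fun X => by
    rw [Ideal.map_map, Ideal.map_map, hcomp, ← Ideal.map_map, ← Ideal.map_map]
  -- the saturations correspond along `g`
  have hS := fun X : Y.IdealSheafData =>
    @map_iSup_colon_singleton_pow_of_ringEquiv (Localization.AtPrime q.asIdeal) _ (Localization.AtPrime 𝔫') _ g
      _ _ (hJ X) _ _ hgtInv
  have hB : ∀ X : Y.IdealSheafData, (stalkIdeal (R.cobordantStrictTransform U X) b).map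
      ((Ψ₀.trans g : (R.cobordantPlus U).presheaf.stalk b ≃+* Localization.AtPrime 𝔫') :
        (R.cobordantPlus U).presheaf.stalk b →+* Localization.AtPrime 𝔫') =
      ⨆ n : ℕ, ((((X.ideal U).map (algebraMap Γ(Y, U) A')).map (algebraMap A' (extReesAlgebra I'))).map
        (algebraMap (extReesAlgebra I') (Localization.AtPrime 𝔫'))).colon
        {algebraMap (extReesAlgebra I') (Localization.AtPrime 𝔫') (extReesAlgebra.tInv I') ^ n} := fun X =>
    (Ideal.map_map (Ψ₀ : (R.cobordantPlus U).presheaf.stalk b →+* Localization.AtPrime q.asIdeal)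
      (g : Localization.AtPrime q.asIdeal →+* Localization.AtPrime 𝔫')).symm.trans
      ((congrArg (Ideal.map (g : Localization.AtPrime q.asIdeal →+* Localization.AtPrime 𝔫')) (hΨ₀ X)).trans (hS X))
  -- (III) off the vertex
  have hV : ¬ extReesAlgebra.vertexIdeal I' ≤ 𝔫' := by
    rw [hgvert]
    exact R.not_vertexIdeal_le_of_cobordantPlus U b q hq
  -- (II) over `𝔪_{A'} = 𝔭_y A'`
  have hM : (maximalIdeal A').map (algebraMap A' (extReesAlgebra I')) ≤ 𝔫' := by
    rw [← IsLocalization.AtPrime.map_eq_maximalIdeal (U.2.primeIdealOf ⟨R.cobordantPlusι U b, hy⟩).asIdeal A',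
      hgprime, Ideal.map_le_iff_le_comap, h𝔭]
  -- over the support of the centre, `t⁻¹ ∈ 𝔫'`
  have hT : R.cobordantPlusι U b ∈ R.support → extReesAlgebra.tInv I' ∈ 𝔫' := fun hsupp => by
    rw [hgT]
    refine extReesAlgebra.tInv_mem_of_forall_le_comap (R.chartIdeals U) q.asIdeal (fun n hn => ?_)
      (R.not_vertexIdeal_le_of_cobordantPlus U b q hq)
    rw [← h𝔭, ReesAlgebraData.chartIdeals_apply]
    exact ideal_le_primeIdealOf_of_mem_support' (R.piece n) U hy ((R.mem_support_iff.mp hsupp) n hn)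
  exact ⟨𝔫', h𝔫', Ψ₀.trans g, hB, hV, hM, hT⟩

/-- **(γ2) THE ORDER READ-OFF.**  Same data.  For an ideal sheaf `X` on `Y`, an element `f ∈ X(U) A'` (e.g. a generator of the
stalk `X_y = X(U) 𝒪_{Y,y}`, `stalkIdeal_eq_map_germ`) and ANY factorisation `f = (t⁻¹)ᵃ g` in the game ring `A'[t⁻¹, I'ₙ tⁿ]`:
`idealOrder (R.cobordantStrictTransform U X) b ≤ adicOrder (g/1)` in `(A'[t⁻¹, I'ₙ tⁿ])_{𝔫'}` — `g/1` lies in the `t⁻¹`-saturation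
of `X(U)`, which is the stalk of the strict transform read through `Ψ` (`exists_gameSide_stalk_model_cobordantPlus`), and
`ord_b ≤ ord` of any member (`idealOrder_le_adicOrder_of_mem`, `adicOrder_map_ringEquiv`).  Together with the three clauses on `𝔫'`
this is exactly the premise set of the LOCAL DROP (β2) `adicOrder_transform_lt` of the (o25) design. [cite: Wlodarczyk2022, 3.3.12] -/
theorem _root_.Literature.AlgebraicGeometry.Resolution.ReesAlgebraData.idealOrder_cobordantStrictTransform_le_adicOrder
    (hanti : Antitone (R.chartIdeals U)) (b : R.cobordantPlus U) (y : Y) (hy : y ∈ (U : Y.Opens))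
    (hb : R.cobordantPlusι U b = y)
    {A' : Type} [CommRing A'] [IsLocalRing A'] [Algebra Γ(Y, U) A']
    [IsLocalization.AtPrime A' (U.2.primeIdealOf ⟨y, hy⟩).asIdeal]
    {I' : ℕ → Ideal A'} (hI' : ∀ n, I' n = (R.chartIdeals U n).map (algebraMap Γ(Y, U) A')) :
    ∃ (𝔫' : Ideal (extReesAlgebra I')) (_ : 𝔫'.IsPrime),
      ¬ extReesAlgebra.vertexIdeal I' ≤ 𝔫' ∧
      (maximalIdeal A').map (algebraMap A' (extReesAlgebra I')) ≤ 𝔫' ∧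
      (y ∈ R.support → extReesAlgebra.tInv I' ∈ 𝔫') ∧
      ∀ (X : Y.IdealSheafData) (f : A'), f ∈ (X.ideal U).map (algebraMap Γ(Y, U) A') →
        ∀ (a : ℕ) (g : extReesAlgebra I'),
          algebraMap A' (extReesAlgebra I') f = extReesAlgebra.tInv I' ^ a * g →
          idealOrder (R.cobordantStrictTransform U X) b ≤
            adicOrder (algebraMap (extReesAlgebra I') (Localization.AtPrime 𝔫') g) := by
  have hm := R.exists_gameSide_stalk_model_cobordantPlus U hanti b y hy hb hI'
  obtain ⟨𝔫', h𝔫', Ψ, hΨ, hV, hM, hT⟩ := hm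
  refine ⟨𝔫', h𝔫', hV, hM, hT, fun X f hf a g hfg => ?_⟩
  -- `f/1/1 ∈ X(U) · (A'[t⁻¹, I'ₙ tⁿ])_{𝔫'}`, hence `g/1 · (t⁻¹/1)ᵃ` does, hence `g/1` lies in the saturation
  have hmem : algebraMap (extReesAlgebra I') (Localization.AtPrime 𝔫') (algebraMap A' (extReesAlgebra I') f) ∈
      (((X.ideal U).map (algebraMap Γ(Y, U) A')).map (algebraMap A' (extReesAlgebra I'))).map
        (algebraMap (extReesAlgebra I') (Localization.AtPrime 𝔫')) :=
    Ideal.mem_map_of_mem _ (Ideal.mem_map_of_mem _ hf)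
  -- (explicit carriers: the instances on the game ring and its localisation are synthesised, not unified)
  have hfac := @map_mul_map_pow_mem_of_eq (extReesAlgebra I') (Localization.AtPrime 𝔫') _ _
    (algebraMap (extReesAlgebra I') (Localization.AtPrime 𝔫')) _ _ _ _ hfg _ hmem
  have hsat := @mem_iSup_colon_of_mul_pow_mem (Localization.AtPrime 𝔫') _ _ _ _ a hfac
  -- the saturation is the stalk of the strict transform read through `Ψ`; compare orders
  exact @idealOrder_le_adicOrder_of_mem_map (R.cobordantPlus U) (R.cobordantStrictTransform U X) b
    (Localization.AtPrime 𝔫') _ _ Ψ _ ((hΨ X).symm ▸ hsat)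

/-- **(γ2) on a WEIGHTED CHART** `(U, u, w)` of `R`: the same read-off with the game ring `A'[t⁻¹, (u^α : w·α ≥ n) tⁿ]` of the
weighted monomial ideals of the images of the chart parameters in the local model `A'` (chart ideals decrease and localise to
these by `IsWeightedChart.ideal_eq` and `weightedMonomialIdeal_map`). [cite: Wlodarczyk2022, Lemma 2.1.12; 3.3.12] -/
theorem _root_.Literature.AlgebraicGeometry.Resolution.ReesAlgebraData.IsWeightedChart.idealOrder_cobordantStrictTransform_le_adicOrder
    {m : ℕ} {u : Fin m → Γ(Y, U)} {w : Fin m → ℕ} (hchart : R.IsWeightedChart U u w)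
    (b : R.cobordantPlus U) (y : Y) (hy : y ∈ (U : Y.Opens)) (hb : R.cobordantPlusι U b = y)
    {A' : Type} [CommRing A'] [IsLocalRing A'] [Algebra Γ(Y, U) A']
    [IsLocalization.AtPrime A' (U.2.primeIdealOf ⟨y, hy⟩).asIdeal] :
    ∃ (𝔫' : Ideal (extReesAlgebra (weightedMonomialIdeal (fun i => algebraMap Γ(Y, U) A' (u i)) w))) (_ : 𝔫'.IsPrime),
      ¬ extReesAlgebra.vertexIdeal (weightedMonomialIdeal (fun i => algebraMap Γ(Y, U) A' (u i)) w) ≤ 𝔫' ∧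
      (maximalIdeal A').map (algebraMap A' (extReesAlgebra (weightedMonomialIdeal (fun i => algebraMap Γ(Y, U) A' (u i)) w))) ≤ 𝔫' ∧
      (y ∈ R.support → extReesAlgebra.tInv (weightedMonomialIdeal (fun i => algebraMap Γ(Y, U) A' (u i)) w) ∈ 𝔫') ∧
      ∀ (X : Y.IdealSheafData) (f : A'), f ∈ (X.ideal U).map (algebraMap Γ(Y, U) A') →
        ∀ (a : ℕ) (g : extReesAlgebra (weightedMonomialIdeal (fun i => algebraMap Γ(Y, U) A' (u i)) w)),
          algebraMap A' _ f = extReesAlgebra.tInv (weightedMonomialIdeal (fun i => algebraMap Γ(Y, U) A' (u i)) w) ^ a * g →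
          idealOrder (R.cobordantStrictTransform U X) b ≤
            adicOrder (algebraMap _ (Localization.AtPrime 𝔫') g) :=
  R.idealOrder_cobordantStrictTransform_le_adicOrder U (hchart.chartIdeals_antitone R U) b y hy hb
    (hchart.weightedMonomialIdeal_map_eq R U)

/-- On a weighted chart a point of `U` lies in the support iff all the chart parameters vanish there; so the `t⁻¹`-clause reads:
over a common zero of the `uᵢ`, the game-side prime contains `t⁻¹` (for the consumer's `η ∈ V(u)`).
[cite: Wlodarczyk2022, 2.1.10] -/
theorem _root_.Literature.AlgebraicGeometry.Resolution.ReesAlgebraData.IsWeightedChart.mem_support_of_forall_germ_mem {m : ℕ}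
    {u : Fin m → Γ(Y, U)} {w : Fin m → ℕ} (hchart : R.IsWeightedChart U u w) {y : Y} (hy : y ∈ (U : Y.Opens))
    (h : ∀ i, (Y.presheaf.germ (U : Y.Opens) y hy).hom (u i) ∈ maximalIdeal (Y.presheaf.stalk y)) : y ∈ R.support := by
  rw [hchart.mem_support_iff R hy]
  intro i hi
  have hu : IsUnit ((Y.presheaf.germ (U : Y.Opens) y hy).hom (u i)) := (Y.mem_basicOpen (u i) y hy).mp hi
  exact mem_nonunits_iff.mp ((IsLocalRing.mem_maximalIdeal _).mp (h i)) hu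

end Rees

end Summit.ResolutionOfSingularities.ResolutionOfSingularities.Theorems.AQSHeightTwo

end
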